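import Summits.BirchSwinnertonDyer.BirchSwinnertonDyer.Theorems.SmallImageMuTransferMuTransferX9TopGenerator
import Literature.NumberTheory.EllipticCurves.ModPImageScalarProofs
import Literature.NumberTheory.EllipticCurves.IwasawaTwistModPDual
import Literature.NumberTheory.GaloisRepresentations.ContinuousH1
import HarnessLib

/-!
# K6 crux `MuTransferX9` (stmt-BirchSwinnertonDyer-19276): MU-TRANSFER-PROOF (F2)/(F8) — the
# CENTRAL SCALAR `z₀` realised inside `Gal(ℚ̄/ℚ_∞)`, Sah's lemma RELATIVE to `G_{L₀}` on the genuine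
# `𝒯_J(E)`, and the depth element `μ_{p^{m₀+1}} ⊄ L₀` — KERNEL

HONEST FRAMING (cell `b2b-bsdres`, X9 prover lineage; verbatim): the cell deletes COMBINATION-SHAPED
residual classes of the rank-≤1 BSD formula from PUBLISHED theorems only and TYPES the
construction-shaped remainder; this is not "finishing BSD".  Theorems only (no definition, no named
fact, no `sorry`); nothing is asserted about any curve beyond what the kernel proves; class X9 stays
TYPED at class level; no pair, count, mark or tier word moves.  Helper file
(`--supports stmt-BirchSwinnertonDyer-19276 --as helper`): it closes no stub and no item.

WHAT IT SERVES.  `HOME/koly/MU-TRANSFER-PROOF.md` (cell `bsd-smallim`, Theorem A = the K6 crux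
`MuTransferX9`) uses in (F8) a central element `z₀ = (λ̄·1, ω̃(λ̄²)) ∈ Gal(L₀/ℚ)`,
`L₀ = ℚ(E[p], μ_{p^{m₀}})`, acting on `𝒯_e = E[p] ⊗ 𝔽_p[T]/T^e (χ)` and on its dual as the scalar
`λ̄ ≠ 1` of (F2), to get (Sah) "restriction `H¹(G_S, 𝒯_e) → Hom_G(G_{L₀}, 𝒯_e)` is INJECTIVE
(independent of cocycle representatives)" — the sentence by which §5 STEP 1 reads the classes
`κ'_e`, `y_e` as equivariant homomorphisms `h`, `h^*` on `G_{L₀}` — and the clause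
"`μ_{p^{m₀+1}} ⊄ L₀`" (the `ℤ/p` factor of `Gal(L'/L₀)` in STEP 2).  The seat k6-c2 (gen 3, STATUS
2026-08-26T10:16Z) names as "remaining for Step 1: the Sah bridge … central `z̃₀` from x9 g41's joint
surjectivity".  This file is that bridge, on the GENUINE objects and at the level of SUBGROUPS of
`Γ_ℚ` (no intermediate field, no quotient group needed):

* §1 (pure, any topological representation `X` of any topological group `G`): Sah's cocycle identity,
  the vanishing of a class and the equality of two classes RELATIVE to a subgroup `N` — for a
  continuous 1-cocycle `φ` vanishing on `N` (resp. two cocycles agreeing on `N`) and an element `z`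
  central MODULO `N` (`z g ∈ g z N`) whose action commutes with `G` and has `z − 1` bijective:
  `[φ] = 0` (resp. `[φ] = [ψ]`) in Mathlib's `continuousCohomology 1 X`
  (`oneCocycleClass_eq_zero_of_forall_mem_eq_zero`, `oneCocycleClass_eq_of_forall_mem_eq`).  The tree's
  `ContinuousH1Sah` (Sah 1968 Prop. 2.7 (b)) is the case `N = 1`, `z` central; the cell's cochain form
  `KolyvaginClass.restriction_injective_of_central_scalar` (p421369) is the same algebra for an abstract
  `ρ : G →* (M →ₗ[Ω] M)`; here it is done for `contOneCocycles`, the currency of `galoisCohomology`.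
* §2 (any field `F`, any `κ : ZpExtension F p`): `Gal(F̄/F_∞) = ker κ` acts on `𝒯_J(E)` through `E[p]`
  alone (`modPTwist_apply_of_mem_kerSubgroup`); an element acting on `E[p]` by a scalar is central in
  `Γ_F` modulo `ker ρ̄_{E,p} ⊓ ker κ'` for every `κ'` with the element in `ker κ'`
  (`exists_mem_inf_mul_eq_of_smul_eq`).
* §3 (`E/ℚ`, `p ≥ 5`, `E[p]` irreducible, `ρ̄_{E,p}` not onto — so on class X9): **the central scalar
  inside `Gal(ℚ̄/ℚ_∞)`**: `∃ σ₀ ∈ ker κ, ∃ a ≠ 1, σ₀|_{E[p]} = a` (`exists_mem_kerSubgroup_smul_eq`; the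
  tree's scalar `exists_galoisRepTorsion_eq_smul_of_not_surjective` (p401231, Serre) moved into `ker κ`
  by GEN 41's joint surjectivity `(ρ̄, κ) : Γ_ℚ ↠ Ḡ × ℤ_p`, p434740); it acts on EVERY `𝒯_J(E)`, for
  `κ` and for the dual twist `κ⁻¹ = κ.invTwist` alike, as `a` (`modPTwist_eq_smul`); hence **two
  continuous 1-cocycles of `Γ_ℚ` in `𝒯_J(E)` (resp. in the `κ⁻¹`-twist) that agree on
  `ker ρ̄_{E,p} ⊓ ker κ` have the same class** (`modPTwist_oneCocycleClass_eq_of_forall_mem_eq`,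
  `invTwist_modPTwist_oneCocycleClass_eq_of_forall_mem_eq`) — a fortiori if they agree on
  `G_{L₀} = ker ρ̄ ⊓ Gal(ℚ̄/ℚ_n) ⊇ ker ρ̄ ⊓ ker κ` (`…_of_forall_mem_layerSubgroup_eq`).
* §4 the depth element: `∃ σ ∈ ker ρ̄_{E,p} ⊓ Gal(ℚ̄/ℚ_n), σ ∉ Gal(ℚ̄/ℚ_{n+1})`
  (`exists_mem_ker_inf_layerSubgroup_not_mem_layerSubgroup_succ`): for the cyclotomic `κ`,
  `μ_{p^{n+2}} ⊄ ℚ(E[p], μ_{p^{n+1}})` — with `n = m₀ − 1`, (F8)'s "`μ_{p^{m₀+1}} ⊄ L₀`".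
* §5 the same on `Rank1Residual.ClassX9 W p` by name.

References: C.-H. Sah, J. Algebra 10 (1968) Prop. 2.7 (b); J.-P. Serre, Invent. Math. 15 (1972) §2.4
Prop. 15, §2.6; L. C. Washington, GTM 83, §13.1–§13.2; `HOME/koly/MU-TRANSFER-PROOF.md` §1 (F2), (F8),
§5 Steps 1–2.  (X9 prover GEN 42, 2026-08-26.)
-/

-- the summit and its single problem are both named `BirchSwinnertonDyer` (registry layout D-0017)
set_option linter.dupNamespace false

set_option autoImplicit false

noncomputable section

open Field WeierstrassCurve Literature.NumberTheory.EllipticCurves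
  Literature.NumberTheory.GaloisRepresentations Function

namespace Summit.BirchSwinnertonDyer.BirchSwinnertonDyer.Rank1Residual

/-! ### §1 Sah's lemma relative to a subgroup, for continuous 1-cocycles -/

namespace SahRel

open _root_.TopRep _root_.ContinuousCohomology

universe u v

variable {R : Type u} [Ring R] [TopologicalSpace R]
variable {G : Type v} [Group G] [TopologicalSpace G] [IsTopologicalGroup G]
variable {X : TopRep.{v} R G}

omit [IsTopologicalGroup G] in
/-- **Sah's cocycle identity relative to a subgroup.** For a continuous crossed homomorphism
`φ : G → X` vanishing on a subgroup `N` and `z ∈ G` central MODULO `N` (`z g = g z n`, `n ∈ N`):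
`z•φ(g) − φ(g) = g•φ(z) − φ(z)` (expand `φ(zg)` and `φ(gzn)`). [cite: Sah1968, Prop. 2.7 (b) and its
proof, p. 60] -/
theorem rho_sub_apply_of_forall_mem_eq_zero (φ : contOneCocycles X) (N : Subgroup G)
    (hφN : ∀ n ∈ N, φ.1 n = 0) {z : G} (hz : ∀ g : G, ∃ n ∈ N, z * g = g * z * n) (g : G) :
    X.ρ z (φ.1 g) - φ.1 g = X.ρ g (φ.1 z) - φ.1 z := by
  obtain ⟨n, hn, hzg⟩ := hz g
  have h1 : φ.1 (z * g) = φ.1 z + X.ρ z (φ.1 g) := φ.2 z g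
  have h2 : φ.1 (g * z * n) = φ.1 g + X.ρ g (φ.1 z) := by
    rw [φ.2 (g * z) n, hφN n hn, map_zero, add_zero, φ.2 g z]
  rw [hzg, h2] at h1
  -- h1 : φ g + ρ g (φ z) = φ z + ρ z (φ g)
  rw [sub_eq_sub_iff_add_eq_add, add_comm (X.ρ z (φ.1 g)), ← h1, add_comm]

/-- **Sah's lemma relative to a subgroup, vanishing form.** Let `φ` be a continuous crossed
homomorphism `G → X` vanishing on `N`, and `z ∈ G` central modulo `N` whose action commutes with that
of `G` and has `x ↦ z•x − x` BIJECTIVE on `X` (e.g. `z` acts by a scalar `λ` with `λ − 1` a unit).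
Then `[φ] = 0` in `H¹_cont(G, X)`: with `v` the solution of `z•v − v = φ(z)`, Sah's identity and the
injectivity of `z − 1` give `φ(g) = g•v − v`. [cite: Sah1968, Prop. 2.7 (b) and its proof, p. 60] -/
theorem oneCocycleClass_eq_zero_of_forall_mem_eq_zero (φ : contOneCocycles X) (N : Subgroup G)
    (hφN : ∀ n ∈ N, φ.1 n = 0) {z : G} (hz : ∀ g : G, ∃ n ∈ N, z * g = g * z * n)
    (hcomm : ∀ (g : G) (x : X), X.ρ z (X.ρ g x) = X.ρ g (X.ρ z x))
    (hbij : Bijective fun x : X => X.ρ z x - x) : oneCocycleClass X φ = 0 := by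
  rw [oneCocycleClass_eq_zero_iff]
  obtain ⟨v, hv⟩ := hbij.2 (φ.1 z)
  have hv' : X.ρ z v - v = φ.1 z := hv
  refine ⟨v, fun g => hbij.1 ?_⟩
  change X.ρ z (φ.1 g) - φ.1 g = X.ρ z (X.ρ g v - v) - (X.ρ g v - v)
  rw [rho_sub_apply_of_forall_mem_eq_zero φ N hφN hz g, ← hv']
  simp only [map_sub]
  rw [hcomm]
  abel

/-- **Sah's lemma relative to a subgroup, injectivity form** (MU-TRANSFER-PROOF (F8): "restriction
`H¹(G, 𝒯_e) → Hom(N, 𝒯_e)` is injective, independent of cocycle representatives"). Two continuous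
crossed homomorphisms `φ, ψ : G → X` that AGREE on `N` have the same class in `H¹_cont(G, X)`, as soon
as some `z` central modulo `N` acts commuting with `G` with `z − 1` bijective.
[cite: Sah1968, Prop. 2.7 (b) and its proof, p. 60] -/
theorem oneCocycleClass_eq_of_forall_mem_eq (φ ψ : contOneCocycles X) (N : Subgroup G)
    (hN : ∀ n ∈ N, φ.1 n = ψ.1 n) {z : G} (hz : ∀ g : G, ∃ n ∈ N, z * g = g * z * n)
    (hcomm : ∀ (g : G) (x : X), X.ρ z (X.ρ g x) = X.ρ g (X.ρ z x))
    (hbij : Bijective fun x : X => X.ρ z x - x) :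
    oneCocycleClass X φ = oneCocycleClass X ψ := by
  rw [← sub_eq_zero, ← oneCocycleClass_sub]
  refine oneCocycleClass_eq_zero_of_forall_mem_eq_zero (φ - ψ) N (fun n hn => ?_) hz hcomm hbij
  change φ.1 n - ψ.1 n = 0
  rw [hN n hn, sub_self]

end SahRel

/-! ### §2 Any field: `ker κ` acts on `𝒯_J(E)` through `E[p]`; a scalar is central modulo `ker ρ̄ ⊓ ker κ` -/

section AnyField

universe u

variable {F : Type u} [Field F] (W : WeierstrassCurve F) (p : ℕ) [Fact p.Prime]
  (κ : ZpExtension F p) (J : ℕ)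

/-- The twist exponent of an element of `ker κ = Gal(F̄/F_∞)` is `0` at every level `J`.
[cite: Washington1997, §13.1–§13.2] -/
theorem twistExponent_eq_zero_of_mem_kerSubgroup {σ : absoluteGaloisGroup F}
    (hσ : σ ∈ κ.kerSubgroup) : κ.twistExponent J σ = 0 := by
  rw [ZpExtension.twistExponent, ZpExtension.mem_kerSubgroup.mp hσ, toAdd_one, map_zero, ZMod.val_zero]

/-- **`Gal(F̄/F_∞) = ker κ` acts on `𝒯_J(E)` through `E[p]` alone, at EVERY level `J`** (the twist
character `χ_κ` is trivial on `ker κ`): `σ•x = (σ•x_i)_i`.  (The tree's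
`modPTwist_apply_of_mem_layerSubgroup` is the finite-layer version, which needs `J ≤ p^m`.)
[cite: Washington1997, §13.1–§13.2] -/
theorem modPTwist_apply_of_mem_kerSubgroup {σ : absoluteGaloisGroup F} (hσ : σ ∈ κ.kerSubgroup)
    (x : Fin J → geomTorsion W p) : W.modPTwist p κ J σ x = fun i => σ • x i := by
  rw [WeierstrassCurve.modPTwist_apply, twistExponent_eq_zero_of_mem_kerSubgroup p κ J hσ,
    unipotentPow_zero, Module.End.one_apply]

/-- An element `σ₀` acting on `E[p]` by a scalar lies in the CENTRE of `Γ_F` MODULO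
`ker ρ̄_{E,p} ⊓ ker κ` as soon as `σ₀ ∈ ker κ`: for every `g`, `σ₀ g = g σ₀ ν` with `ν` acting
trivially on `E[p]` and `κ ν = 1` (`ν = σ₀⁻¹ g⁻¹ σ₀ g`; a scalar commutes with `ρ̄(g)`, and `κ` is a
homomorphism to an abelian group).  This is the hypothesis "`z` central modulo `N`" of §1 for
`N = ker ρ̄ ⊓ ker κ ≤ G_{L₀}`. [cite: Serre1972, §2.6] [cite: Washington1997, §13.1] -/
theorem exists_mem_inf_mul_eq_of_smul_eq {σ₀ : absoluteGaloisGroup F} {a : ℕ}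
    (hσ₀ : ∀ P : geomTorsion W p, σ₀ • P = a • P) (hκ : σ₀ ∈ κ.kerSubgroup)
    (g : absoluteGaloisGroup F) :
    ∃ ν ∈ (galoisRepTorsion W p).ker ⊓ κ.kerSubgroup, σ₀ * g = g * σ₀ * ν := by
  refine ⟨σ₀⁻¹ * g⁻¹ * σ₀ * g, Subgroup.mem_inf.mpr ⟨?_, ?_⟩, by group⟩
  · rw [MonoidHom.mem_ker]
    apply Multiplicative.toAdd.injective
    refine AddEquiv.ext fun P => ?_
    rw [galoisRepTorsion_apply, toAdd_one, AddAut.zero_apply, mul_smul, mul_smul, mul_smul, hσ₀,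
      smul_comm g⁻¹ a, inv_smul_smul, ← hσ₀, inv_smul_smul]
  · rw [ZpExtension.mem_kerSubgroup] at hκ ⊢
    rw [map_mul, map_mul, map_mul, map_inv, map_inv, hκ, inv_one, one_mul, mul_one, inv_mul_cancel]

end AnyField

/-! ### §3 Over `ℚ`, `p ≥ 5`, `E[p]` irreducible, `ρ̄_{E,p}` not onto: the central scalar inside `Gal(ℚ̄/ℚ_∞)` -/

section Rat

variable (W : WeierstrassCurve ℚ) [W.IsElliptic] (p : ℕ) [Fact p.Prime] (κ : ZpExtension ℚ p)

/-- **The central scalar `z₀` of MU-TRANSFER-PROOF (F2)/(F8), realised INSIDE `Gal(ℚ̄/ℚ_∞)`.** For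
`E/ℚ`, `p ≥ 5`, `E[p]` irreducible and `ρ̄_{E,p}` not onto, and ANY `ℤ_p`-extension `κ` of `ℚ`: some
`σ₀ ∈ ker κ` acts on `E[p]` as a scalar `a ∈ 𝔽_p`, `a ≠ 1`.  (Serre: the image, of order prime to `p`
with `det` onto and no fixed line, contains a scalar `≠ 1` — tree
`exists_galoisRepTorsion_eq_smul_of_not_surjective`; then move it into `ker κ` along the joint
surjectivity `(ρ̄, κ) : Γ_ℚ ↠ Ḡ × ℤ_p` of GEN 41, p434740.)  In the memo's coordinates
`z₀ = (λ̄·1, ω̃(λ̄²))`: `ρ̄(σ₀) = λ̄·1` and `σ₀` fixes `ℚ_∞` (so `χ_cyc(σ₀)` is the Teichmüller lift of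
`det ρ̄(σ₀) = λ̄²` when `κ` is cyclotomic). [cite: Serre1972, §2.4 Prop. 15 and §2.6]
[cite: Washington1997, §13.1] -/
theorem exists_mem_kerSubgroup_smul_eq (hp5 : 5 ≤ p) (hirr : W.HasIrreducibleModPGaloisRep p)
    (hns : ¬ W.HasSurjectiveModNGaloisRep p) :
    ∃ (σ₀ : absoluteGaloisGroup ℚ) (a : ZMod p), a ≠ 1 ∧ σ₀ ∈ κ.kerSubgroup ∧
      ∀ P : geomTorsion W p, σ₀ • P = a.val • P := by
  obtain ⟨σ, a, ha1, hσ⟩ := exists_galoisRepTorsion_eq_smul_of_not_surjective W p hp5 hirr hns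
  obtain ⟨σ₀, hρ, hκ⟩ :=
    exists_galoisRepTorsion_eq_and_eq_of_irreducible_of_not_surjective W p κ hirr hns σ 1
  refine ⟨σ₀, a, ha1, ZpExtension.mem_kerSubgroup.mpr hκ, fun P => ?_⟩
  rw [← galoisRepTorsion_apply, hρ]
  exact hσ P

/-- **`z₀` acts on every `𝒯_J(E)` as the scalar `a`** (for `κ`, and — same element, same kernel — for
any unit twist of `κ`, in particular the dual twist `κ⁻¹ = κ.invTwist`): `σ₀ ∈ ker κ` kills the twist
character and `σ₀|_{E[p]} = a`. [cite: Washington1997, §13.1–§13.2] -/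
theorem modPTwist_eq_smul_of_mem_kerSubgroup {F : Type*} [Field F] (W' : WeierstrassCurve F)
    (κ' : ZpExtension F p) (J : ℕ) {σ₀ : absoluteGaloisGroup F} {a : ℕ}
    (hσ₀ : ∀ P : geomTorsion W' p, σ₀ • P = a • P) (hκ : σ₀ ∈ κ'.kerSubgroup)
    (x : Fin J → geomTorsion W' p) : W'.modPTwist p κ' J σ₀ x = a • x := by
  rw [modPTwist_apply_of_mem_kerSubgroup W' p κ' J hκ]
  funext i
  rw [hσ₀, Pi.smul_apply]

/-- `x ↦ a•x − x` is BIJECTIVE on `𝒯_J(E)` for `a ∈ 𝔽_p`, `a ≠ 1`: it is multiplication by the unit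
`a − 1` of `𝔽_p` on an `𝔽_p`-vector space (`E[p]` is killed by `p`). [cite: Serre1972, §2.6] -/
theorem bijective_smul_sub_self {F : Type*} [Field F] (W' : WeierstrassCurve F) (J : ℕ) {a : ZMod p}
    (ha : a ≠ 1) :
    Bijective fun x : Fin J → geomTorsion W' p => a.val • x - x := by
  letI : Module (ZMod p) (geomTorsion W' p) := AddSubgroup.torsionBy.zmodModule
  have hfun : (fun x : Fin J → geomTorsion W' p => a.val • x - x) =
      fun x => (Units.mk0 (a - 1) (sub_ne_zero.mpr ha)) • x := by
    funext x
    rw [Units.smul_mk0, sub_smul, one_smul, ← Nat.cast_smul_eq_nsmul (ZMod p) a.val x,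
      ZMod.natCast_zmod_val]
  rw [hfun]
  exact MulAction.bijective _

/-- **Sah's lemma on the genuine `𝒯_J(E)` (MU-TRANSFER-PROOF (F8), the injectivity sentence), subgroup
form.** For `E/ℚ`, `p ≥ 5`, `E[p]` irreducible, `ρ̄_{E,p}` not onto, any `κ : ZpExtension ℚ p` and any
level `J`: two continuous 1-cocycles of `Γ_ℚ` with values in `𝒯_J(E) = W.modPTwist p κ J` that agree
on `ker ρ̄_{E,p} ⊓ ker κ = Gal(ℚ̄/ℚ(E[p])·ℚ_∞)` have the SAME class in `H¹(ℚ, 𝒯_J(E))`.  (Relative Sah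
§1 with `z = σ₀` of `exists_mem_kerSubgroup_smul_eq`: central modulo `ker ρ̄ ⊓ ker κ`, acting as the
scalar `a ≠ 1`, which commutes with `Γ_ℚ` and has `a − 1` invertible.)
[cite: Sah1968, Prop. 2.7 (b) and its proof, p. 60] [cite: Serre1972, §2.4 Prop. 15 and §2.6] -/
theorem modPTwist_oneCocycleClass_eq_of_forall_mem_eq (hp5 : 5 ≤ p)
    (hirr : W.HasIrreducibleModPGaloisRep p) (hns : ¬ W.HasSurjectiveModNGaloisRep p) (J : ℕ)
    (φ ψ : contOneCocycles (W.modPTwist p κ J).toTopRep)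
    (hN : ∀ ν ∈ (galoisRepTorsion W p).ker ⊓ κ.kerSubgroup, φ.1 ν = ψ.1 ν) :
    oneCocycleClass _ φ = oneCocycleClass _ ψ := by
  obtain ⟨σ₀, a, ha1, hκ, hσ₀⟩ := exists_mem_kerSubgroup_smul_eq W p κ hp5 hirr hns
  have hρσ₀ : ∀ x : (W.modPTwist p κ J).toTopRep,
      (W.modPTwist p κ J).toTopRep.ρ σ₀ x = a.val • x :=
    fun x => modPTwist_eq_smul_of_mem_kerSubgroup p W κ J hσ₀ hκ x
  refine SahRel.oneCocycleClass_eq_of_forall_mem_eq φ ψ _ hN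
    (exists_mem_inf_mul_eq_of_smul_eq W p κ hσ₀ hκ) (fun g x => ?_) ?_
  · rw [hρσ₀, hρσ₀, map_nsmul]
  · have : (fun x : (W.modPTwist p κ J).toTopRep => (W.modPTwist p κ J).toTopRep.ρ σ₀ x - x) =
        fun x : Fin J → geomTorsion W p => a.val • x - x := by
      funext x
      rw [hρσ₀]
    rw [this]
    exact bijective_smul_sub_self p W J ha1

/-- Vanishing form of the previous theorem: a continuous 1-cocycle of `Γ_ℚ` in `𝒯_J(E)` that VANISHES
on `ker ρ̄_{E,p} ⊓ ker κ` is a coboundary. [cite: Sah1968, Prop. 2.7 (b) and its proof, p. 60]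
[cite: Serre1972, §2.4 Prop. 15 and §2.6] -/
theorem modPTwist_oneCocycleClass_eq_zero_of_forall_mem_eq_zero (hp5 : 5 ≤ p)
    (hirr : W.HasIrreducibleModPGaloisRep p) (hns : ¬ W.HasSurjectiveModNGaloisRep p) (J : ℕ)
    (φ : contOneCocycles (W.modPTwist p κ J).toTopRep)
    (hN : ∀ ν ∈ (galoisRepTorsion W p).ker ⊓ κ.kerSubgroup, φ.1 ν = 0) :
    oneCocycleClass _ φ = 0 := by
  rw [← oneCocycleClass_zero (W.modPTwist p κ J).toTopRep]
  exact modPTwist_oneCocycleClass_eq_of_forall_mem_eq W p κ hp5 hirr hns J φ 0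
    (fun ν hν => by rw [hN ν hν]; rfl)

/-- **The literal (F8) reading: agreement on `G_{L₀} = ker ρ̄_{E,p} ⊓ Gal(ℚ̄/ℚ_n)` suffices**
(`L₀ = ℚ(E[p])·ℚ_n`, `ℚ_n` the `n`-th layer of `κ`; `G_{L₀} ⊇ ker ρ̄ ⊓ ker κ`), at every layer `n` and
every level `J`. [cite: Sah1968, Prop. 2.7 (b) and its proof, p. 60] [cite: Serre1972, §2.4 Prop. 15 and §2.6] -/
theorem modPTwist_oneCocycleClass_eq_of_forall_mem_layerSubgroup_eq (hp5 : 5 ≤ p)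
    (hirr : W.HasIrreducibleModPGaloisRep p) (hns : ¬ W.HasSurjectiveModNGaloisRep p) (J n : ℕ)
    (φ ψ : contOneCocycles (W.modPTwist p κ J).toTopRep)
    (hN : ∀ ν ∈ (galoisRepTorsion W p).ker ⊓ κ.layerSubgroup n, φ.1 ν = ψ.1 ν) :
    oneCocycleClass _ φ = oneCocycleClass _ ψ :=
  modPTwist_oneCocycleClass_eq_of_forall_mem_eq W p κ hp5 hirr hns J φ ψ fun ν hν =>
    hN ν (Subgroup.mem_inf.mpr
      ⟨(Subgroup.mem_inf.mp hν).1, κ.kerSubgroup_le_layerSubgroup n (Subgroup.mem_inf.mp hν).2⟩)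

/-- **The dual side (MU-TRANSFER-PROOF (4.1): the dual deformation carries `χ⁻¹`).** The same
injectivity for continuous 1-cocycles in the `κ⁻¹`-twist `W.modPTwist p κ.invTwist J` (the model of
`𝒯_J(E)^*` used by seats k6-ty / k6-c2, `ZpExtension.twistDualMap`), with the SAME subgroup
`ker ρ̄_{E,p} ⊓ ker κ` (`ker κ⁻¹ = ker κ`). [cite: Sah1968, Prop. 2.7 (b) and its proof, p. 60]
[cite: Serre1972, §2.4 Prop. 15 and §2.6] -/
theorem invTwist_modPTwist_oneCocycleClass_eq_of_forall_mem_eq (hp5 : 5 ≤ p)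
    (hirr : W.HasIrreducibleModPGaloisRep p) (hns : ¬ W.HasSurjectiveModNGaloisRep p) (J : ℕ)
    (φ ψ : contOneCocycles (W.modPTwist p κ.invTwist J).toTopRep)
    (hN : ∀ ν ∈ (galoisRepTorsion W p).ker ⊓ κ.kerSubgroup, φ.1 ν = ψ.1 ν) :
    oneCocycleClass _ φ = oneCocycleClass _ ψ := by
  refine modPTwist_oneCocycleClass_eq_of_forall_mem_eq W p κ.invTwist hp5 hirr hns J φ ψ ?_
  rw [ZpExtension.kerSubgroup_unitTwist]
  exact hN

/-! ### §4 The depth element of (F8): `μ_{p^{m₀+1}} ⊄ L₀` -/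

/-- **`∃ σ ∈ ker ρ̄_{E,p} ⊓ Gal(ℚ̄/ℚ_n)` with `σ ∉ Gal(ℚ̄/ℚ_{n+1})`** for `E/ℚ` with `E[p]` irreducible
and `ρ̄_{E,p}` not onto, every `κ : ZpExtension ℚ p` and every `n`: the element with `ρ̄(σ) = 1` and
`κ(σ) = pⁿ` given by GEN 41's joint surjectivity (p434740).  For the cyclotomic `κ` and `n = m₀ − 1`
this is (F8)'s "`μ_{p^{m₀+1}} ⊄ L₀ = ℚ(E[p], μ_{p^{m₀}})`": the field `ℚ(E[p])·ℚ_n` fixed by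
`ker ρ̄ ⊓ Gal(ℚ̄/ℚ_n)` does not contain the layer `ℚ_{n+1}`. [cite: Serre1972, §2.4 Prop. 15]
[cite: Washington1997, §13.1] -/
theorem exists_mem_ker_inf_layerSubgroup_not_mem_layerSubgroup_succ
    (hirr : W.HasIrreducibleModPGaloisRep p) (hns : ¬ W.HasSurjectiveModNGaloisRep p) (n : ℕ) :
    ∃ σ ∈ (galoisRepTorsion W p).ker ⊓ κ.layerSubgroup n, σ ∉ κ.layerSubgroup (n + 1) := by
  obtain ⟨σ, hρ, hκ⟩ := exists_galoisRepTorsion_eq_and_eq_of_irreducible_of_not_surjective W p κ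
    hirr hns 1 (Multiplicative.ofAdd ((p : ℤ_[p]) ^ n))
  have hp : Prime (p : ℤ_[p]) := PadicInt.prime_p
  refine ⟨σ, Subgroup.mem_inf.mpr ⟨?_, ?_⟩, ?_⟩
  · rw [MonoidHom.mem_ker, hρ, map_one]
  · rw [ZpExtension.mem_layerSubgroup, hκ, toAdd_ofAdd]
  · rw [ZpExtension.mem_layerSubgroup, hκ, toAdd_ofAdd, pow_dvd_pow_iff hp.ne_zero hp.not_unit]
    omega

/-- Value form of the depth element: `∃ σ` with `ρ̄_{E,p}(σ) = 1` and `κ(σ) = pⁿ·y` for any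
prescribed `y ∈ ℤ_p` — `κ` maps `ker ρ̄_{E,p} ⊓ Gal(ℚ̄/ℚ_n)` ONTO `pⁿ ℤ_p = Gal(ℚ_∞/ℚ_n)`.
[cite: Serre1972, §2.4 Prop. 15] [cite: Washington1997, §13.1] -/
theorem exists_galoisRepTorsion_eq_one_and_eq_pow_mul
    (hirr : W.HasIrreducibleModPGaloisRep p) (hns : ¬ W.HasSurjectiveModNGaloisRep p) (n : ℕ)
    (y : ℤ_[p]) :
    ∃ σ ∈ (galoisRepTorsion W p).ker ⊓ κ.layerSubgroup n,
      κ σ = Multiplicative.ofAdd ((p : ℤ_[p]) ^ n * y) := by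
  obtain ⟨σ, hρ, hκ⟩ := exists_galoisRepTorsion_eq_and_eq_of_irreducible_of_not_surjective W p κ
    hirr hns 1 (Multiplicative.ofAdd ((p : ℤ_[p]) ^ n * y))
  refine ⟨σ, Subgroup.mem_inf.mpr ⟨?_, ?_⟩, hκ⟩
  · rw [MonoidHom.mem_ker, hρ, map_one]
  · rw [ZpExtension.mem_layerSubgroup, hκ, toAdd_ofAdd]
    exact dvd_mul_right _ _

/-! ### §5 Class X9 -/

variable [W.IsGloballyMinimal]

/-- **On class X9, the central scalar inside `Gal(ℚ̄/ℚ_∞)`**: for every `ℤ_p`-extension `κ` of `ℚ`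
some `σ₀ ∈ ker κ` acts on `E[p]` by a scalar `a ≠ 1` (MU-TRANSFER-PROOF (F2)/(F8) `z₀`).
[cite: Serre1972, §2.4 Prop. 15 and §2.6] [cite: Washington1997, §13.1] -/
theorem ClassX9.exists_mem_kerSubgroup_smul_eq (h : ClassX9 W p) :
    ∃ (σ₀ : absoluteGaloisGroup ℚ) (a : ZMod p), a ≠ 1 ∧ σ₀ ∈ κ.kerSubgroup ∧
      ∀ P : geomTorsion W p, σ₀ • P = a.val • P :=
  Rank1Residual.exists_mem_kerSubgroup_smul_eq W p κ h.2.1 h.2.2.2.2.1 h.2.2.2.2.2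

/-- **On class X9, Sah on the genuine `𝒯_J(E)`**: two continuous 1-cocycles of `Γ_ℚ` in
`W.modPTwist p κ J` agreeing on `ker ρ̄_{E,p} ⊓ ker κ` have the same class (MU-TRANSFER-PROOF (F8):
restriction to `G_{L₀}` is injective on `H¹`). [cite: Sah1968, Prop. 2.7 (b) and its proof, p. 60]
[cite: Serre1972, §2.4 Prop. 15 and §2.6] -/
theorem ClassX9.modPTwist_oneCocycleClass_eq_of_forall_mem_eq (h : ClassX9 W p) (J : ℕ)
    (φ ψ : contOneCocycles (W.modPTwist p κ J).toTopRep)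
    (hN : ∀ ν ∈ (galoisRepTorsion W p).ker ⊓ κ.kerSubgroup, φ.1 ν = ψ.1 ν) :
    oneCocycleClass _ φ = oneCocycleClass _ ψ :=
  Rank1Residual.modPTwist_oneCocycleClass_eq_of_forall_mem_eq W p κ h.2.1 h.2.2.2.2.1 h.2.2.2.2.2 J
    φ ψ hN

/-- **On class X9, Sah on the dual twist `W.modPTwist p κ.invTwist J`** (same subgroup
`ker ρ̄_{E,p} ⊓ ker κ`). [cite: Sah1968, Prop. 2.7 (b) and its proof, p. 60]
[cite: Serre1972, §2.4 Prop. 15 and §2.6] -/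
theorem ClassX9.invTwist_modPTwist_oneCocycleClass_eq_of_forall_mem_eq (h : ClassX9 W p) (J : ℕ)
    (φ ψ : contOneCocycles (W.modPTwist p κ.invTwist J).toTopRep)
    (hN : ∀ ν ∈ (galoisRepTorsion W p).ker ⊓ κ.kerSubgroup, φ.1 ν = ψ.1 ν) :
    oneCocycleClass _ φ = oneCocycleClass _ ψ :=
  Rank1Residual.invTwist_modPTwist_oneCocycleClass_eq_of_forall_mem_eq W p κ h.2.1 h.2.2.2.2.1
    h.2.2.2.2.2 J φ ψ hN

/-- **On class X9, the depth element**: `∃ σ ∈ ker ρ̄_{E,p} ⊓ Gal(ℚ̄/ℚ_n)`, `σ ∉ Gal(ℚ̄/ℚ_{n+1})`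
(MU-TRANSFER-PROOF (F8): `μ_{p^{m₀+1}} ⊄ L₀`). [cite: Serre1972, §2.4 Prop. 15]
[cite: Washington1997, §13.1] -/
theorem ClassX9.exists_mem_ker_inf_layerSubgroup_not_mem_layerSubgroup_succ (h : ClassX9 W p)
    (n : ℕ) : ∃ σ ∈ (galoisRepTorsion W p).ker ⊓ κ.layerSubgroup n, σ ∉ κ.layerSubgroup (n + 1) :=
  Rank1Residual.exists_mem_ker_inf_layerSubgroup_not_mem_layerSubgroup_succ W p κ h.2.2.2.2.1
    h.2.2.2.2.2 n

end Rat

end Summit.BirchSwinnertonDyer.BirchSwinnertonDyer.Rank1Residual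

end
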